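import Literature.Geometry.Kaehler.ComplexTorusAnalyticClassesProducts
import Literature.Geometry.Kaehler.ComplexTorusHodgeClassesDimension
import Literature.Geometry.Kaehler.ComplexTorusRationalHodgeStructurePullback
import Literature.Geometry.Kaehler.ComplexTorusPontryaginFunctorial
import Literature.Geometry.Kaehler.ComplexTorusCupProductHodgeStructure
import HarnessLib

/-!
# The cup product of analytic classes, I: reduction of `[Y₁] ∧ [Y₂] ∈ A(X)` to a fibre formula

Layer `Literature/Geometry/Kaehler`, namespace `Literature.Geometry.Kaehler.ComplexTorus`; lane
`lit-hodgefound`, seat p07, programme «THE ANALYTIC CLASSES OF A COMPLEX TORUS FORM A RING», file 1.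
The tree has the analytic classes `Aᵖ(X) = analyticClasses Φ e p ⊆ H^{2p}_Hodge(X)` of a complex torus
`X = E/Φ(ℤ^ι)` (the `ℚ`-span of the fundamental classes `[Z]_e` of closed analytic subsets of
codimension `p`, `ComplexTorusAnalyticClasses.lean`), their exterior products on `X₁ × X₂`
(`ComplexTorusAnalyticClassesProducts.lean`) and, on an abelian variety, `Dᵖ(X) = span {[Y₁] ∧ ⋯ ∧ [Y_p]}`
(`ComplexTorusDivisorClassesHypersurfaces.lean`), and records as missing the product formula making
`A•(X)` a ring and giving `Dᵖ(X) ⊆ Aᵖ(X)` ("the cycle classes in `D•` are all algebraic", Lange 2023,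
§7.3.1, p. 336). In algebraic geometry `[Y₁] · [Y₂] = Δ^*([Y₁] × [Y₂])` is the pull-back of the exterior
product along the diagonal (Fulton, §8.1), computed by moving `Y₂` by a general translation (Fulton
§11.4, Kleiman); on a complex torus the translations are available globally, and this file reduces the
statement `[Y₁] ∧ [Y₂] ∈ A^{p₁+p₂}(X)` to a FIBRE FORMULA for one analytic subset of `X × X`, as follows.

* §1 `mem_of_mem_span_complex_of_le_rationalForms` — **`(W ⊗_ℚ ℂ) ∩ Hᵏ(X, ℚ) = W`** for a `ℚ`-subspace
  `W ⊆ Hᵏ(X, ℚ)` (the rational classes are a `ℚ`-structure of `Hᵏ(X, ℂ)`, Lange Cor. 1.1.19;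
  `finrank_span_complex_eq`).
* §2 `mem_span_complex_of_forall_poincarePairing_eq_zero` — the double annihilator for the perfect
  Poincaré pairing; **`mem_analyticClasses_of_poincarePairing_eq_integral`** — a RATIONAL class `η` with
  `⟨γ, η⟩ = c ∫ ⟨γ, cl(Z_t)⟩ dμ(t)` for all `γ` (any measure space of parameters `t`, `cl = setCycleClass`)
  is an analytic class.
* §3 the shear `σ = ρ(⟨1 0; 1 1⟩) : (x, y) ↦ (x, x + y)` of `X × X` (Euclidean presentation `prodPeriodL2`):
  `isIsogeny_prodPeriodL2_shear` (an automorphism), `realRep_prodPeriodL2_shear_apply`,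
  `realRep_inlMatrix_prodPeriodL2_apply` (`i₀ : x ↦ (x, 0)`), `realRep_shear_realRep_inlMatrix_apply`
  (`σ ∘ i₀ = Δ`), `cross_compContinuousLinearMap_shear_inl` (`i₀^* σ^* (pr₁^*α ∧ pr₂^*β) = α ∧ β`),
  **`wedge_analyticCycleClass_eq_compContinuousLinearMap_inl`** — **`[Y₁] ∧ [Y₂] = i₀^*[σ⁻¹(Y₁ × Y₂)]`**
  (`[Y₁ × Y₂] = pr₁^*[Y₁] ∧ pr₂^*[Y₂]`, `[σ⁻¹W] = σ^*[W]`), `mapMatrix_shear_symm_prodHomeomorphL2`,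
  **`shear_preimage_prod_fibre`** — the fibre of `σ⁻¹(Y₁ × Y₂)` over `t ∈ X` (second factor) is
  `Y₁ ∩ (Y₂ - t)`, `compContinuousLinearMap_realRep_inlMatrix_mem_rationalForms`, and the reduction
  **`wedge_analyticCycleClass_mem_analyticClasses_of_poincarePairing_eq_integral`**: if
  `⟨γ, [Y₁] ∧ [Y₂]⟩ = c ∫ ⟨γ, cl(Z_t)⟩ dμ(t)` for all `γ` (for instance with `Z_t = Y₁ ∩ (Y₂ - t)`: the
  fibre formula for `i₀^*[σ⁻¹(Y₁ × Y₂)]`, file 2 of the programme), then `[Y₁] ∧ [Y₂] ∈ A^{p₁+p₂}(X)`.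

Theorems only; no new definitions, no named facts.

## References

* [Lange2023AbelianVarietiesComplex] H. Lange, *Abelian Varieties over the Complex Numbers*, Springer
  2023, §1.1.2 (rational/analytic representations, Lemma 1.1.11), §1.1.3 Cor. 1.1.19, Exercise 1.1.6 (7),
  §6.2.1–§6.2.2 (cycle class map, Prop. 6.2.9), §6.2.4 (p. 310), §7.2.2, §7.3.1 (pp. 335–336).
* [Fulton1998] W. Fulton, *Intersection Theory*, 2nd ed., Springer 1998, §8.1, §8.3, Example 11.4.5,
  §19.2 Prop. 19.2.
* [VoisinHodgeI2002] C. Voisin, *Hodge Theory and Complex Algebraic Geometry I*, CUP 2002, §11.1.2,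
  §11.3.3 (11.11).
* [LangeBirkenhake1992] H. Lange, Ch. Birkenhake, *Complex Abelian Varieties*, Springer 1992, §5.3.
-/

noncomputable section

open scoped Manifold
open MeasureTheory Set Function Module WithLp
open Literature.LinearAlgebra.Alternating

namespace Literature.Geometry.Kaehler

namespace ComplexTorus

universe u

/-! ## §1. Rational classes in the complex span of a `ℚ`-subspace of `Hᵏ(X, ℚ)` -/

section RationalStructure

variable {ι : Type*} [Fintype ι] {E : Type*} [NormedAddCommGroup E] [NormedSpace ℂ E]
  (Φ : (ι → ℝ) ≃L[ℝ] E)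

/-- **`(W ⊗_ℚ ℂ) ∩ Hᵏ(X, ℚ) = W`** for a `ℚ`-subspace `W ⊆ Hᵏ(X, ℚ)`: a RATIONAL class lying in the
complex span of `W` lies in `W` (rational classes are a `ℚ`-structure of `Hᵏ(X, ℂ)`: adjoining the class
to `W` does not change the complex span, hence not the `ℚ`-dimension, `finrank_span_complex_eq`).
[cite: Lange2023AbelianVarietiesComplex, §1.1.3 Cor. 1.1.19 and §7.2.2] -/
theorem mem_of_mem_span_complex_of_le_rationalForms {k : ℕ} {W : Submodule ℚ (E [⋀^Fin k]→L[ℝ] ℂ)}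
    (hW : W ≤ rationalForms Φ k) {η : E [⋀^Fin k]→L[ℝ] ℂ} (hη : η ∈ rationalForms Φ k)
    (hspan : η ∈ Submodule.span ℂ (W : Set (E [⋀^Fin k]→L[ℝ] ℂ))) : η ∈ W := by
  by_contra hηW
  set W' : Submodule ℚ (E [⋀^Fin k]→L[ℝ] ℂ) := W ⊔ ℚ ∙ η with hW'def
  have hW' : W' ≤ rationalForms Φ k :=
    sup_le hW ((Submodule.span_singleton_le_iff_mem η _).2 hη)
  -- the complex spans agree
  have hspan' : Submodule.span ℂ (W' : Set (E [⋀^Fin k]→L[ℝ] ℂ)) =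
      Submodule.span ℂ (W : Set (E [⋀^Fin k]→L[ℝ] ℂ)) := by
    refine le_antisymm (Submodule.span_le.2 fun x hx ↦ ?_)
      (Submodule.span_mono (fun x hx ↦ (le_sup_left : W ≤ W') hx))
    obtain ⟨w, hw, y, hy, rfl⟩ := Submodule.mem_sup.1 hx
    obtain ⟨q, rfl⟩ := Submodule.mem_span_singleton.1 hy
    refine add_mem (Submodule.subset_span hw) ?_
    rw [← Rat.cast_smul_eq_qsmul ℂ q]
    exact Submodule.smul_mem _ _ hspan
  -- hence the `ℚ`-dimensions agree
  haveI := finiteDimensional_of_le_rationalForms Φ hW'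
  have h1 : finrank ℚ W' = finrank ℚ W := by
    rw [← finrank_span_complex_eq Φ hW', ← finrank_span_complex_eq Φ hW, hspan']
  -- but `η ∉ W`
  have hlt : W < W' := by
    refine lt_of_le_of_ne le_sup_left fun h ↦ hηW ?_
    rw [h]
    exact Submodule.mem_sup_right (Submodule.mem_span_singleton_self η)
  have h2 := Submodule.finrank_lt_finrank_of_lt hlt
  omega

end RationalStructure

/-! ## §2. The double annihilator for the Poincaré pairing; the averaging criterion -/

section Annihilator

variable {ι : Type*} [Fintype ι] [DecidableEq ι] {E : Type u} [NormedAddCommGroup E]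
  [InnerProductSpace ℂ E] [FiniteDimensional ℂ E] [MeasurableSpace E] [BorelSpace E]
  (Φ : (ι → ℝ) ≃L[ℝ] E) {n : ℕ} (e : Fin n ≃ ι)

omit [MeasurableSpace E] [BorelSpace E] in
/-- **Double annihilator**: a class `η ∈ Hˡ(X, ℂ)` killed by every `γ ∈ Hᵏ(X, ℂ)` (`k + l = 2 dim X`)
which kills a set `S` lies in the complex span of `S` — the Poincaré pairing is perfect
(`poincarePairing_isPerfPair`), so every linear functional on `Hˡ(X, ℂ)` is `⟨γ, ·⟩`.
[cite: Lange2023AbelianVarietiesComplex, §6.2.4 (p. 310)] -/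
theorem mem_span_complex_of_forall_poincarePairing_eq_zero {k l : ℕ} (h : k + l = n)
    {S : Set (E [⋀^Fin l]→L[ℝ] ℂ)} {η : E [⋀^Fin l]→L[ℝ] ℂ}
    (hη : ∀ γ : E [⋀^Fin k]→L[ℝ] ℂ, (∀ s ∈ S, poincarePairing Φ e h γ s = 0) →
      poincarePairing Φ e h γ η = 0) :
    η ∈ Submodule.span ℂ S := by
  by_contra hcon
  obtain ⟨f, hfη, hfS⟩ := Submodule.exists_dual_map_eq_bot_of_notMem hcon inferInstance
  obtain ⟨γ, hγ⟩ := (poincarePairing Φ e h).toPerfPair.surjective f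
  have hγf : ∀ x, poincarePairing Φ e h γ x = f x := fun x ↦ by
    rw [← hγ, LinearMap.toPerfPair_apply]
  refine hfη ?_
  rw [← hγf]
  refine hη γ fun s hs ↦ ?_
  rw [hγf]
  have hmem : f s ∈ (Submodule.span ℂ S).map f := Submodule.mem_map_of_mem (Submodule.subset_span hs)
  rw [hfS] at hmem
  exact (Submodule.mem_bot ℂ).1 hmem

variable {d p : ℕ} (h : 2 * d + 2 * p = n)

/-- **A rational class which pairs like a superposition of classes of analytic subsets is an analytic
class.** If `η ∈ H^{2p}(X, ℚ)` satisfies `⟨γ, η⟩ = c ∫ ⟨γ, cl(Z_t)⟩ dμ(t)` for every `γ ∈ H^{2d}(X, ℂ)`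
(`cl(Z_t) = setCycleClass`, the class of `Z_t` or `0`; any measure space of parameters, any constant),
then `η ∈ Aᵖ(X)`: every `γ` annihilating `Aᵖ(X)` annihilates each `cl(Z_t)`, hence `η`, so `η` lies in
`Aᵖ(X) ⊗ ℂ` (double annihilator), and a rational class in `Aᵖ(X) ⊗ ℂ` lies in `Aᵖ(X)`.
[cite: Lange2023AbelianVarietiesComplex, §7.3.1 (p. 335) and §1.1.3 Cor. 1.1.19] -/
theorem mem_analyticClasses_of_poincarePairing_eq_integral {T : Type*} [MeasurableSpace T]
    (μ : Measure T) (Z : T → Set (ComplexTorus Φ)) (c : ℂ) {η : E [⋀^Fin (2 * p)]→L[ℝ] ℂ}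
    (hη : η ∈ rationalForms Φ (2 * p))
    (havg : ∀ γ : E [⋀^Fin (2 * d)]→L[ℝ] ℂ, poincarePairing Φ e h γ η =
      c * ∫ t, poincarePairing Φ e h γ (setCycleClass Φ e h (Z t)) ∂μ) :
    η ∈ analyticClasses Φ e p := by
  refine mem_of_mem_span_complex_of_le_rationalForms Φ (analyticClasses_le_rationalForms Φ e p) hη ?_
  refine mem_span_complex_of_forall_poincarePairing_eq_zero Φ e h fun γ hγ ↦ ?_
  rw [havg γ]
  have h0 : ∀ t, poincarePairing Φ e h γ (setCycleClass Φ e h (Z t)) = 0 := fun t ↦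
    hγ _ (setCycleClass_mem_analyticClasses Φ e h (Z t))
  simp only [h0, integral_zero, mul_zero]

end Annihilator

/-! ## §3. The cup product as the restriction to the diagonal: the shear of `X × X` -/

section Shear

variable {ι : Type*} [Fintype ι] [DecidableEq ι] {E : Type u} [NormedAddCommGroup E]
  [InnerProductSpace ℂ E] [FiniteDimensional ℂ E] [MeasurableSpace E] [BorelSpace E]
  (Φ : (ι → ℝ) ≃L[ℝ] E)

omit [DecidableEq ι] [FiniteDimensional ℂ E] [MeasurableSpace E] [BorelSpace E] in
/-- The Euclidean period map of `X × X` on a split coordinate vector: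
`prodPeriodL2 Φ Φ (a ⊔ b) = (Φ a, Φ b)`. [cite: LangeBirkenhake1992, §5.3] -/
theorem prodPeriodL2_sumElim (a b : ι → ℝ) :
    prodPeriodL2 Φ Φ (Sum.elim a b) = toLp 2 (Φ a, Φ b) := by
  rw [prodPeriodL2_apply, prodPeriod_apply]
  rfl

omit [FiniteDimensional ℂ E] [MeasurableSpace E] [BorelSpace E] in
/-- **The analytic representation of the shear** `σ = ρ(⟨1 0; 1 1⟩) : X × X → X × X`,
`(x, y) ↦ (x, x + y)`: `ρ_a(σ)(x, y) = (x, x + y)` on `WithLp 2 (E × E)`.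
[cite: Lange2023AbelianVarietiesComplex, §1.1.2 (rational and analytic representations)] -/
theorem realRep_prodPeriodL2_shear_apply (x y : E) :
    realRep (prodPeriodL2 Φ Φ) (prodPeriodL2 Φ Φ) (Matrix.fromBlocks 1 0 1 1) (toLp 2 (x, y)) =
      toLp 2 (x, x + y) := by
  have hxy : toLp 2 (x, y) = prodPeriodL2 Φ Φ (Sum.elim (Φ.symm x) (Φ.symm y)) := by
    rw [prodPeriodL2_sumElim, ContinuousLinearEquiv.apply_symm_apply, ContinuousLinearEquiv.apply_symm_apply]
  rw [hxy, realRep_apply, Matrix.fromBlocks_map, Matrix.fromBlocks_mulVec, Sum.elim_comp_inl,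
    Sum.elim_comp_inr, Matrix.map_one Int.cast Int.cast_zero Int.cast_one, Matrix.map_zero Int.cast Int.cast_zero,
    Matrix.one_mulVec, Matrix.one_mulVec, Matrix.zero_mulVec, add_zero, prodPeriodL2_sumElim, map_add,
    ContinuousLinearEquiv.apply_symm_apply, ContinuousLinearEquiv.apply_symm_apply]

omit [FiniteDimensional ℂ E] [MeasurableSpace E] [BorelSpace E] in
/-- **The shear `σ : (x, y) ↦ (x, x + y)` is an isogeny (an automorphism) of `X × X`**: its analytic
representation is `ℂ`-linear and `det ⟨1 0; 1 1⟩ = 1`. [cite: Lange2023AbelianVarietiesComplex, §1.1.2 Lemma 1.1.11] -/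
theorem isIsogeny_prodPeriodL2_shear :
    IsIsogeny (prodPeriodL2 Φ Φ) (prodPeriodL2 Φ Φ) (Matrix.fromBlocks 1 0 1 1 : Matrix (ι ⊕ ι) (ι ⊕ ι) ℤ) := by
  refine (isIsogeny_iff_det_ne_zero (prodPeriodL2 Φ Φ) (prodPeriodL2 Φ Φ) _).2 ⟨?_, ?_⟩
  · -- the `ℂ`-linear analytic representation `(x, y) ↦ (x, x + y)`
    refine ⟨((WithLp.prodContinuousLinearEquiv 2 ℂ E E).symm : E × E →L[ℂ] WithLp 2 (E × E)).comp
      ((((ContinuousLinearMap.fst ℂ E E).prod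
        (ContinuousLinearMap.fst ℂ E E + ContinuousLinearMap.snd ℂ E E))).comp
        (WithLp.prodContinuousLinearEquiv 2 ℂ E E : WithLp 2 (E × E) →L[ℂ] E × E)), fun v ↦ ?_⟩
    conv_lhs => rw [← Sum.elim_comp_inl_inr v]
    conv_rhs => rw [← Sum.elim_comp_inl_inr v]
    rw [Matrix.fromBlocks_map, Matrix.fromBlocks_mulVec, Sum.elim_comp_inl, Sum.elim_comp_inr,
      Matrix.map_one Int.cast Int.cast_zero Int.cast_one, Matrix.map_zero Int.cast Int.cast_zero,
      Matrix.one_mulVec, Matrix.one_mulVec, Matrix.zero_mulVec, add_zero, prodPeriodL2_sumElim,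
      prodPeriodL2_sumElim, map_add]
    rfl
  · rw [Matrix.det_fromBlocks_zero₁₂]
    simp

omit [FiniteDimensional ℂ E] [MeasurableSpace E] [BorelSpace E] in
/-- **The analytic representation of the inclusion `i₀ : X → X × X'`, `x ↦ (x, 0)`** (rational
representation `⟨1; 0⟩ = inlMatrix`): `ρ_a(i₀)(x) = (x, 0)` on `WithLp 2 (E × E')`.
[cite: Lange2023AbelianVarietiesComplex, §1.1.2] -/
theorem realRep_inlMatrix_prodPeriodL2_apply {ι' : Type*} [Fintype ι'] {E' : Type*} [NormedAddCommGroup E']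
    [InnerProductSpace ℂ E'] (Φ' : (ι' → ℝ) ≃L[ℝ] E') (x : E) :
    realRep Φ (prodPeriodL2 Φ Φ') (inlMatrix ι ι') x = toLp 2 (x, 0) := by
  have hx : x = Φ (Φ.symm x) := (ContinuousLinearEquiv.apply_symm_apply Φ x).symm
  rw [hx, realRep_apply, inlMatrix, Matrix.fromRows_map, Matrix.fromRows_mulVec,
    Matrix.map_one Int.cast Int.cast_zero Int.cast_one, Matrix.map_zero Int.cast Int.cast_zero,
    Matrix.one_mulVec, Matrix.zero_mulVec, prodPeriodL2_apply, prodPeriod_apply, ← hx]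
  simp only [Sum.elim_inl, Sum.elim_inr]
  exact congrArg (fun z ↦ toLp 2 (z, Φ' 0)) (Φ.apply_symm_apply x) |>.trans (by rw [map_zero])

omit [FiniteDimensional ℂ E] [MeasurableSpace E] [BorelSpace E] in
/-- `σ ∘ i₀ = Δ`: the shear carries the slice `X × {0}` onto the diagonal, `ρ_a(σ)(x, 0) = (x, x)`.
[cite: Lange2023AbelianVarietiesComplex, §6.2.2 (the diagonal as a graph)] -/
theorem realRep_shear_realRep_inlMatrix_apply (x : E) :
    realRep (prodPeriodL2 Φ Φ) (prodPeriodL2 Φ Φ) (Matrix.fromBlocks 1 0 1 1)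
      (realRep Φ (prodPeriodL2 Φ Φ) (inlMatrix ι ι) x) = toLp 2 (x, x) := by
  rw [realRep_inlMatrix_prodPeriodL2_apply, realRep_prodPeriodL2_shear_apply, add_zero]

omit [FiniteDimensional ℂ E] [MeasurableSpace E] [BorelSpace E] in
/-- **Cup product = cross product restricted to the diagonal**, the diagonal being the shear image of
the slice `X × {0}`: `i₀^* σ^* (pr₁^*α ∧ pr₂^*β) = Δ^*(pr₁^*α ∧ pr₂^*β) = α ∧ β` on invariant forms.
[cite: Lange2023AbelianVarietiesComplex, §6.2.2 Prop. 6.2.9 (proof: `Δ^*(α × β) = α · β`)] [cite: VoisinHodgeI2002, §11.3.3 (11.11)] -/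
theorem cross_compContinuousLinearMap_shear_inl {k l : ℕ} (α : E [⋀^Fin k]→L[ℝ] ℂ) (β : E [⋀^Fin l]→L[ℝ] ℂ) :
    ((((α.compContinuousLinearMap (ContinuousLinearMap.fst ℝ E E)).wedge
        (β.compContinuousLinearMap (ContinuousLinearMap.snd ℝ E E))).compContinuousLinearMap
        (WithLp.prodContinuousLinearEquiv 2 ℝ E E : WithLp 2 (E × E) →L[ℝ] E × E)).compContinuousLinearMap
        (realRep (prodPeriodL2 Φ Φ) (prodPeriodL2 Φ Φ) (Matrix.fromBlocks 1 0 1 1))).compContinuousLinearMap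
        (realRep Φ (prodPeriodL2 Φ Φ) (inlMatrix ι ι)) = α.wedge β := by
  ext v
  simp only [ContinuousAlternatingMap.compContinuousLinearMap_apply, ContinuousAlternatingMap.wedge_apply,
    Function.comp_def, realRep_shear_realRep_inlMatrix_apply]
  rfl

variable {n : ℕ} (e : Fin n ≃ ι) {d₁ d₂ k₁ k₂ : ℕ}

/-- **`[Y₁] ∧ [Y₂] = i₀^*[σ⁻¹(Y₁ × Y₂)]`**: the cup product of the classes of two closed analytic subsets
`Y₁, Y₂ ⊆ X` is the restriction to the slice `X × {0}` of the class of the analytic subset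
`σ⁻¹(Y₁ × Y₂) = {(x, y) : x ∈ Y₁, x + y ∈ Y₂}` of `X × X` (`[Y₁ × Y₂] = pr₁^*[Y₁] ∧ pr₂^*[Y₂]`,
`analyticCycleClass_prodL2`; `[σ⁻¹ W] = σ^*[W]` for the automorphism `σ`,
`IsIsogeny.analyticCycleClass_preimage_of_orientationSign_eq`; `Δ = σ ∘ i₀`).
[cite: Fulton1998, §8.1 (the diagonal) and §19.2 Prop. 19.2] [cite: Lange2023AbelianVarietiesComplex, §6.2.1–§6.2.2] -/
theorem wedge_analyticCycleClass_eq_compContinuousLinearMap_inl (hk₁ : 2 * d₁ + k₁ = n) (hk₂ : 2 * d₂ + k₂ = n)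
    (hk : 2 * (d₁ + d₂) + (k₁ + k₂) = n + n) {Y₁ Y₂ : Set (ComplexTorus Φ)}
    (hY₁ : HasPureDim 𝓘(ℂ, E) Y₁ d₁) (hY₂ : HasPureDim 𝓘(ℂ, E) Y₂ d₂) :
    (analyticCycleClass Φ e hk₁ hY₁).wedge (analyticCycleClass Φ e hk₂ hY₂) =
      (analyticCycleClass (prodPeriodL2 Φ Φ) (sumEnum e e) hk
        ((isIsogeny_prodPeriodL2_shear Φ).hasPureDim_preimage (prodPeriodL2 Φ Φ) (prodPeriodL2 Φ Φ)
          (hasPureDim_preimage_prodHomeomorphL2_prod Φ Φ hY₁ hY₂))).compContinuousLinearMap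
        (realRep Φ (prodPeriodL2 Φ Φ) (inlMatrix ι ι)) := by
  rw [(isIsogeny_prodPeriodL2_shear Φ).analyticCycleClass_preimage_of_orientationSign_eq (prodPeriodL2 Φ Φ)
      (prodPeriodL2 Φ Φ) (sumEnum e e) (sumEnum e e) (hasPureDim_preimage_prodHomeomorphL2_prod Φ Φ hY₁ hY₂)
      hk rfl,
    analyticCycleClass_prodL2 Φ Φ hY₁ hY₂ e e hk₁ hk₂ hk, cross_compContinuousLinearMap_shear_inl]

omit [FiniteDimensional ℂ E] [MeasurableSpace E] [BorelSpace E] in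
/-- **The shear in lattice coordinates**: `σ(x ⊔ y) = x ⊔ (x + y)` on `(ℝ/ℤ)^(ι ⊔ ι)`.
[cite: Lange2023AbelianVarietiesComplex, §1.1.2] -/
theorem mapMatrix_shear_symm_prodHomeomorphL2 (x y : ComplexTorus Φ) :
    mapMatrix (prodPeriodL2 Φ Φ) (prodPeriodL2 Φ Φ) (Matrix.fromBlocks 1 0 1 1)
        ((prodHomeomorphL2 Φ Φ).symm (x, y)) = (prodHomeomorphL2 Φ Φ).symm (x, x + y) := by
  have hsymm : ∀ a b : ComplexTorus Φ, ((prodHomeomorphL2 Φ Φ).symm (a, b) : ι ⊕ ι → AddCircle (1 : ℝ)) =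
      Sum.elim a b := fun a b ↦ rfl
  rw [hsymm, hsymm]
  funext s
  rw [mapMatrix_apply, Fintype.sum_sum_type]
  cases s with
  | inl i =>
    simp only [Matrix.fromBlocks_apply₁₁, Matrix.fromBlocks_apply₁₂, Sum.elim_inl, Sum.elim_inr,
      Matrix.zero_apply, zero_smul, Finset.sum_const_zero, add_zero, Matrix.one_apply, ite_smul, one_smul,
      Finset.sum_ite_eq, Finset.mem_univ, if_true]
  | inr j =>
    simp only [Matrix.fromBlocks_apply₂₁, Matrix.fromBlocks_apply₂₂, Sum.elim_inl, Sum.elim_inr,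
      Matrix.one_apply, ite_smul, one_smul, zero_smul, Finset.sum_ite_eq, Finset.mem_univ, if_true]
    rfl

omit [FiniteDimensional ℂ E] [MeasurableSpace E] [BorelSpace E] in
/-- **The fibres of `σ⁻¹(Y₁ × Y₂) → X` over the second factor are the intersections with the
translates**: `{x : (x, t) ∈ σ⁻¹(Y₁ × Y₂)} = Y₁ ∩ (Y₂ - t)`.
[cite: Fulton1998, §8.1 and Example 11.4.5] [cite: Lange2023AbelianVarietiesComplex, §6.2.2] -/
theorem shear_preimage_prod_fibre (Y₁ Y₂ : Set (ComplexTorus Φ)) (t : ComplexTorus Φ) :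
    {x | (prodHomeomorphL2 Φ Φ).symm (x, t) ∈
      mapMatrix (prodPeriodL2 Φ Φ) (prodPeriodL2 Φ Φ) (Matrix.fromBlocks 1 0 1 1) ⁻¹'
        (prodHomeomorphL2 Φ Φ ⁻¹' (Y₁ ×ˢ Y₂))} = Y₁ ∩ (fun x ↦ x + t) ⁻¹' Y₂ := by
  ext x
  simp only [mem_setOf_eq, mem_preimage, mapMatrix_shear_symm_prodHomeomorphL2, Homeomorph.apply_symm_apply,
    mem_prod, mem_inter_iff]

omit [FiniteDimensional ℂ E] [MeasurableSpace E] [BorelSpace E] in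
/-- `i₀^* = (x ↦ (x, 0))^*` preserves the rational classes: `i₀^* Hᵐ(X × X', ℚ) ⊆ Hᵐ(X, ℚ)`.
[cite: Lange2023AbelianVarietiesComplex, §1.1.3 Exercise 1.1.6 (7)] -/
theorem compContinuousLinearMap_realRep_inlMatrix_mem_rationalForms {ι' : Type*} [Fintype ι'] {E' : Type*}
    [NormedAddCommGroup E'] [InnerProductSpace ℂ E'] (Φ' : (ι' → ℝ) ≃L[ℝ] E') {m : ℕ}
    {ω : WithLp 2 (E × E') [⋀^Fin m]→L[ℝ] ℂ} (hω : ω ∈ rationalForms (prodPeriodL2 Φ Φ') m) :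
    ω.compContinuousLinearMap (realRep Φ (prodPeriodL2 Φ Φ') (inlMatrix ι ι')) ∈ rationalForms Φ m :=
  comp_realRep_mem_rationalForms Φ (prodPeriodL2 Φ Φ') (inlMatrix ι ι') hω

variable {p₁ p₂ q : ℕ}

/-- **THE REDUCTION.** If the cup product `[Y₁] ∧ [Y₂]` of the classes of two closed analytic subsets of
`X` (`Yᵢ` of codimension `pᵢ`), read in degree `2(p₁ + p₂)`, pairs with every `γ ∈ H^{2q}(X, ℂ)`
(`q = dim X - p₁ - p₂`) like a superposition `c ∫ ⟨γ, cl(Z_t)⟩ dμ(t)` of total classes of subsets of `X`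
— for `Z_t = Y₁ ∩ (Y₂ - t)`, the fibres of `σ⁻¹(Y₁ × Y₂)` over the second factor, this is the FIBRE
FORMULA for `i₀^*[σ⁻¹(Y₁ × Y₂)] = [Y₁] ∧ [Y₂]` — then `[Y₁] ∧ [Y₂]` is an analytic class:
`[Y₁] ∧ [Y₂] ∈ A^{p₁+p₂}(X)`. [cite: Lange2023AbelianVarietiesComplex, §7.3.1 (pp. 335–336)] [cite: Fulton1998, §8.3 and §19.2] -/
theorem wedge_analyticCycleClass_mem_analyticClasses_of_poincarePairing_eq_integral
    (hk₁ : 2 * d₁ + 2 * p₁ = n) (hk₂ : 2 * d₂ + 2 * p₂ = n) (hq : 2 * q + 2 * (p₁ + p₂) = n)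
    {Y₁ Y₂ : Set (ComplexTorus Φ)} (hY₁ : HasPureDim 𝓘(ℂ, E) Y₁ d₁) (hY₂ : HasPureDim 𝓘(ℂ, E) Y₂ d₂)
    {T : Type*} [MeasurableSpace T] (μ : Measure T) (Z : T → Set (ComplexTorus Φ)) (c : ℂ)
    (havg : ∀ γ : E [⋀^Fin (2 * q)]→L[ℝ] ℂ, poincarePairing Φ e hq γ
      (((analyticCycleClass Φ e hk₁ hY₁).wedge (analyticCycleClass Φ e hk₂ hY₂)).domDomCongr
        (finCongr (by ring))) = c * ∫ t, poincarePairing Φ e hq γ (setCycleClass Φ e hq (Z t)) ∂μ) :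
    ((analyticCycleClass Φ e hk₁ hY₁).wedge (analyticCycleClass Φ e hk₂ hY₂)).domDomCongr
      (finCongr (by ring)) ∈ analyticClasses Φ e (p₁ + p₂) := by
  refine mem_analyticClasses_of_poincarePairing_eq_integral Φ e hq μ Z c ?_ havg
  exact (cupProduct Φ (by ring : 2 * p₁ + 2 * p₂ = 2 * (p₁ + p₂))
    ⟨analyticCycleClass Φ e hk₁ hY₁, analyticCycleClass_mem_rationalForms Φ e hk₁ hY₁⟩
    ⟨analyticCycleClass Φ e hk₂ hY₂, analyticCycleClass_mem_rationalForms Φ e hk₂ hY₂⟩).2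

end Shear

end ComplexTorus

end Literature.Geometry.Kaehler

end
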